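import Literature.Geometry.Lorentzian.MassInequalities
import HarnessLib

/-!
# Exterior regions: the trapped set, Huisken–Ilmanen's Lemma 4.1, and the Riemannian Penrose
# inequality for exterior regions (family `gr`, statement **gr.S09**; namespace
# `Literature.Geometry.Lorentzian`)

This file decomposes the named fact `riemannian_penrose_inequality_connected_smooth` of
`MassInequalities.lean` (Huisken–Ilmanen, J. Differential Geom. 59 (2001), Main Theorem combined
with their Lemma 4.1, for a connected outermost minimal surface `S` of time-symmetric data on a
boundaryless `3`-manifold `X`) into the three printed ingredients of that combination, each
vendored as a named fact in the *open-set encoding* forced by the H21 setting (regions of the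
boundaryless data manifold `X` instead of manifolds with boundary), and **proves** the
combination from them:

* `exteriorRegion_structure` — Huisken–Ilmanen, §4, Lemma 4.1 (i) and the paragraph preceding
  it: for a region `V ⊆ X` with compact minimal boundary and one asymptotically flat end, the
  trapped set `K(V)` is compact, `V ∖ K(V)` is the (connected) exterior component `U` of the end,
  and the topological boundary of `U` is a compact embedded minimal surface whose components are
  `2`-spheres;
* `riemannian_penrose_inequality_exteriorRegion` — the Main Theorem itself, for an exterior
  region presented as an open `U ⊆ X` with compact minimal boundary `∂U` containing no other
  compact minimal surface: `m ≥ 0` and `√(|N|/16π) ≤ m` for every component `N` of `∂U`;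
* `minimalSurface_boundary_maximumPrinciple` — the strong (geometric) maximum principle for
  minimal surfaces in the boundary form used in §4 of Huisken–Ilmanen: a connected compact embedded
  minimal surface lying outside `U` and touching `∂U` lies in `∂U` (Andersson–Galloway–Howard
  1998, Thm. 3.10; Eschenburg 1989, Thm. 1); a named fact here, **proved** downstream in
  `MinimalSurfaceBarrier.lean` (which imports this file) from the local barrier (tangency)
  principle for minimal surfaces in slice-chart form, `minimalSurface_barrierPrinciple`, by the
  purely topological slice-box argument sketched in its docstring
  (`minimalSurface_boundary_maximumPrinciple_of_barrierPrinciple`);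
* `riemannian_penrose_inequality_connected_smooth_of_exteriorRegion` — **theorem**: the three
  facts imply `riemannian_penrose_inequality_connected_smooth`. This is the reduction (a) of the
  module docstring of `MassInequalities.lean`, now machine-checked: the exterior component `U` of
  `V = S.exterior` either has `S` among its boundary components (then the Main Theorem applies to
  `S`), or `S` touches `∂U` from outside (excluded by the maximum principle), or `∂U` is a compact
  minimal — hence weakly outer trapped — surface inside `S.exterior` enclosing `S` with compact
  region `closure (S.exterior ∖ U) ⊆ K(V)` in between, excluded by
  `OutermostMOTS.no_weaklyOuterTrapped_in_exterior`. With the maximum principle discharged this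
  becomes `riemannian_penrose_inequality_connected_smooth_of_barrierPrinciple`
  (`MinimalSurfaceBarrier.lean`): `exteriorRegion_structure →
  riemannian_penrose_inequality_exteriorRegion → minimalSurface_barrierPrinciple →
  riemannian_penrose_inequality_connected_smooth`.

The analytic core of Huisken–Ilmanen (weak inverse mean curvature flow, §§1–3, Geroch
monotonicity §5, jumps §6, asymptotics §7; see `InverseMeanCurvatureFlow.lean`) sits entirely
inside `riemannian_penrose_inequality_exteriorRegion`; the minimal-surface theory of §4
(Meeks–Simon–Yau, Meeks–Yau, the loop theorem) inside `exteriorRegion_structure`.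

## Known exception (2026-08-15): `exteriorRegion_structure` is refuted as stated

Huisken–Ilmanen state Lemma 4.1 (i) for the **metric completion** `M'` of a component of
`M ∖ K`, not for its closure: *"We take the metric completion rather than the closure because
some component of `K` might be a nonseparating surface"* (§4, the sentence following
Lemma 4.1); in the proof of (i), each surface of `∂K` *"is either a component of `K`, or bounds
`K` on one side"*, and the spherical topology of `∂M'` comes from (ii), whose proof observes that
*"by simple connectedness, [`M'`] contains no one-sided `ℝP²`"*. A component of `K(V)` which is a
compact embedded **one-sided** minimal surface `P ⊆ V` (a component of `K` of the first kind) is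
covered twice by a `2`-sphere of `∂M'`; as a subset of `frontier U`, `U = V ∖ K(V)`, it is the
image of no embedding carrying a continuous unit normal. The conclusion vendored below, however,
asks for `B : MinimalBoundary D.h U`: a smooth **embedding** `B.f` with `range B.f = frontier U`
and a **smooth** unit normal `B.ν` along it, all components `2`-spheres. The statement is
therefore false as written. A counterexample meeting every hypothesis is the time-symmetric
slice of the `ℝP³` geon (Baker–Galloway, Comm. Math. Phys. 336 (2015), §3: the quotient of the
Schwarzschild slice `(ℝ³ ∖ {0}, (1 + m/2r)⁴ δ)` by the free isometric involution
`x ↦ -(m/2)² x/|x|²`; it *"has one asymptotically flat end (identical to an end in the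
Schwarzschild slice), and contains a projective plane `Σ` that is covered by the unique minimal
sphere `Σ̃`"* of the Schwarzschild slice, and *"`Σ` is not two-sided"*), taken with `V = univ`
and the empty minimal boundary `MinimalBoundary.univ`: the slice is complete with `R = 0`,
`IsExteriorRegion e univ` and `IsMetricAsymptoticallyFlat e D 1` hold for its Schwarzschild end
`e`; every compact immersed minimal surface of the slice lifts (through the pullback of the
double cover) to one of the Schwarzschild slice, in which every compact immersed minimal surface
has image the horizon `r = m/2` (maximum principle against the foliations of the two ends by the
mean-convex coordinate spheres `r = const`), so `K₁(univ) = Σ`; `X ∖ Σ` is connected and not precompact,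
so `K(univ) = Σ ≅ ℝP²`, `U = X ∖ Σ` is the Schwarzschild exterior, `frontier U = Σ` is
one-sided, and no `B` exists (nor is `Σ` a sphere). The refutation is informal — Mathlib (at the
pin) has no quotient manifolds in which to build the geon slice — and is recorded, binder by
binder, with the ledger (fact claim on `exteriorRegion_structure` released 2026-08-15 with
outcome `refuted`) and in `PenroseRigidityProofs.lean`, last section, which also proves the
topological step of the corrected reduction (a compact one-sided surface does not separate a
connected open set).

Consequences. Every theorem taking `(h1 : exteriorRegion_structure)` as a hypothesis — in this
file `riemannian_penrose_inequality_connected_smooth_of_exteriorRegion`; downstream those of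
`OutermostHorizon.lean`, `OutermostHorizonSmooth.lean`, `MinimalSurfaceBarrier.lean`,
`MinimalGraphMaximumPrinciple.lean`, `MassInequalitiesProofs.lean` and
`PenroseRigidityProofs.lean` — is a correct but *vacuous* implication. The definition is kept
verbatim: it cannot be marked `@[deprecated]` while these users exist without breaking the
warning-free build, and its meaning is not edited in place. A faithful vendoring of Lemma 4.1
(i) has to present `∂M'` as a compact surface with `2`-sphere components **immersed** onto
`frontier U` with smooth unit normal pointing into `U` — one-to-one over the components of
`frontier U` that bound `K(V)` on one side, two-to-one (the orientation double cover, resp. the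
two sides) over the one-sided components and over the two-sided components on both of whose
sides `U` lies — and the facts consuming `∂U` together with its area (Huisken–Ilmanen's Main
Theorem, Bray's Thm. 19) then count that area with multiplicity, `A = |∂M'|`, as their sources
do. No such statement is in the tree yet. For the corrected gr.S09 statements
(`riemannian_penrose_inequality_smooth`, `riemannian_penrose_rigidity_smooth`) the hypothesis
`IsMinimalSurfaceFree D.h S.exterior` excludes the two-sided pieces of `∂K` inside `S.exterior`
but not one-sided minimal projective planes `P_i` there; in the sources these are harmless for
the inequality (`16π m² ≥ A = |∂M'| = |S| + 2 Σ_i |P_i| ≥ |S|` in Bray's form, the spheres of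
`∂M'` over the `P_i` only adding to `A`; `|N| ≤ 16π m²` for each component `N` of `∂M'` in
Huisken–Ilmanen's) and are excluded in the case of equality only a posteriori, by the same count
with `|S| = 16π m²`.

## Mathlib

Mathlib (at the pin) has smooth embeddings `Manifold.IsSmoothEmbedding` (with the slice-chart
definition of immersions, `Manifold.IsImmersion`), but no minimal surfaces, no maximum principle
for (quasilinear) elliptic equations on manifolds and no manifolds with boundary obtained as
closures or metric completions of open regions; we use `TopologicalSpace.Opens`, `frontier`,
`closure`, `connectedComponentIn`, `connectedComponent`, `Metric.sphere`, `Homeomorph`, `𝓝[>]`,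
and the H21 Lorentz prelude
(`OutermostMOTS`, `IsMaximalSlice`, `IsUnitNormal`, `IsSpacelikeImmersion`, `NormalField`,
`contMDiff_pullbackBilin`, `inducedRiemannianMetric`, `totalArea`, `curveThrough`, `AFEnd`,
`IsMetricAsymptoticallyFlat`, `HasADMEnergy`, `admEnergy`, `InitialDataSet.IsComplete`,
`isMOTSInData_zero_iff`) together with `IsExteriorRegion e U` of `MassInequalities.lean`
(`U` connected, containing a far region `e.far R'` of the end, `closure U ∖ e.far R'` compact),
which expresses "one end, the asymptotically flat end `e`" in all three facts. The positive
notion `IsMinimalSurfaceImage` (image of a compact *immersed* minimal surface with *smooth* unit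
normal along it) is the building block of `K₁`; the existing negative predicate
`IsMinimalSurfaceFree h U` of `MassInequalities.lean` (no nonempty compact *embedded* minimal
surface, with an arbitrary unit normal, has image in the open `U`) in particular forbids every
`IsMinimalSurfaceImage` set parametrised by an embedding from lying in `U`; it is not used here.

## Design choices

* *Open-set encoding of manifolds with boundary.* Huisken–Ilmanen work on a complete
  `3`-manifold `M` "allowed to have a smooth, compact boundary consisting of minimal surfaces"
  (§4) and on the metric completion `M'` of a component of `M ∖ K`. Here the ambient object is a
  region `V` (resp. `U`) of the boundaryless data manifold `X`, open, whose topological boundary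
  `frontier V` is the image of a compact smoothly embedded surface with vanishing mean curvature
  and a *smooth* unit normal pointing into the region (`MinimalBoundary`, a hypothesis structure
  in the style of `OutermostMOTS`; smoothness of the normal makes `IsMaximalSlice` the honest
  equation `H = 0`, cf. the section "corrected statement" of `MassInequalities.lean`). The printed
  `M` is `closure V` (a component of `frontier V` along which `V` lies on both sides is an
  interior minimal surface of `closure V`, as Huisken–Ilmanen's metric completion makes explicit
  by doubling it); the printed `M'` is the metric completion of `U`. Accordingly the images of
  compact immersed minimal surfaces "in `M`" are the `IsMinimalSurfaceImage` sets contained in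
  `closure V`, and `K₁(V)`, `K(V)` (`trappedCore`, `trappedSet`) are literally Huisken–Ilmanen's
  `K₁`, `K` for `M = closure V`.
* *Immersed surfaces enter through two-sided parametrisations.* `IsMinimalSurfaceImage h N` asks
  for a compact surface `S₀`, an immersion `f` with `range f = N`, and a smooth unit normal field
  `ν` *along `f`* with `H = 0`; an immersion with non-trivial normal bundle has the same image as
  its composition with the orientation double cover of that bundle, so no image is lost.
* *One surface type for a disconnected boundary.* `MinimalBoundary` carries a single compact
  (possibly disconnected, possibly empty) surface type `surf` and one embedding `f`; Mathlib has
  no charted-space structure on `Σ i, M i`, and a single type is what the outermost condition of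
  `OutermostMOTS` consumes. Components are `connectedComponent y ⊆ surf`. The structure is
  inhabited: `OutermostMOTS.toMinimalBoundary` (the horizon bounding its exterior) and
  `MinimalBoundary.ofFrontierEqEmpty`/`.univ` (empty boundary, on the `EmptySurface`).
* *Areas of boundary components.* In `riemannian_penrose_inequality_exteriorRegion` the area
  `|N|` of a component `N` of `∂U` is `totalArea` of the metric induced on *any* compact connected
  surface `S₀` smoothly embedded into `X` with image in `∂U = range B.f` (such an image is a whole
  component of `∂U`, by invariance of domain in dimension `2`, and `totalArea (f₀^* h)` is its
  Riemannian area, Federer 1969, §3.2.46); this is the form in which `OutermostMOTS.surfaceArea`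
  enters, so no separate area-comparison fact is needed.
* *Faithfulness.* Each fact carries the hypotheses of its source or stronger ones, and asserts
  its conclusions or weaker ones; the docstrings say which clauses are not vendored (Lemma 4.1
  (ii): the topology of `M'` and the homological area-minimising property of `∂M'`; the rigidity
  clause of the Main Theorem). **Exception:** the conclusion of `exteriorRegion_structure` is
  stronger than the printed one (closure in place of metric completion) and false as written —
  section "Known exception" above.

## References

* G. Huisken, T. Ilmanen, *The inverse mean curvature flow and the Riemannian Penrose
  inequality*, J. Differential Geom. 59 (2001) 353–437: §0, (0.1)–(0.3) and Main Theorem;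
  §4, "Exterior and Trapped Regions" and Lemma 4.1; §8, Proof of Main Theorem, step 1.
* L. Andersson, G. J. Galloway, R. Howard, *A strong maximum principle for weak solutions of
  quasi-linear elliptic equations with applications to Lorentzian and Riemannian geometry*,
  Comm. Pure Appl. Math. 51 (1998) 581–624 (arXiv:dg-ga/9707015): Def. 3.9 and Thm. 3.10
  (geometric maximum principle for Riemannian manifolds).
* J.-H. Eschenburg, *Maximum principle for hypersurfaces*, Manuscripta Math. 64 (1989) 55–75,
  Thm. 1.
* J. M. Lee, *Introduction to Smooth Manifolds*, 2nd ed., Springer 2013, Prop. 5.2 (images of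
  embeddings) and Thm. 5.8 (local slice criterion).
* H. Federer, *Geometric Measure Theory*, Springer 1969, §3.2.46.
* K. L. Baker, G. J. Galloway, *On the topology of initial data sets with higher genus ends*,
  Comm. Math. Phys. 336 (2015) 431–440 (arXiv:1403.0988): §3, the `ℝP³` geon (the
  counterexample of section "Known exception"). (key `BakerGalloway2015`)
-/

noncomputable section

open Bundle Set Manifold TopologicalSpace Filter MeasureTheory
open scoped ContDiff Topology ENNReal Manifold Real

namespace Literature.Geometry.Lorentzian

open PseudoRiemannianMetric

variable {X : Type*} [TopologicalSpace X] [ChartedSpace E3 X] [IsManifold (𝓡 3) ∞ X]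

/-! ### Images of compact minimal surfaces; the trapped set of a region -/

section TrappedSet

variable (h : ContMDiffRiemannianMetric (𝓡 3) ∞ E3 (TangentSpace (𝓡 3) : X → Type _))
  [(ofRiemannian h).HasLeviCivita]

/-- `N ⊆ X` is *the image of a compact immersed minimal surface* of the Riemannian `3`-manifold
`(X, h)` (Huisken–Ilmanen, J. Differential Geom. 59 (2001), §4, "the images of all smooth,
compact, immersed minimal surfaces"): there are a nonempty compact Hausdorff surface `S₀`
(without boundary, `S₀ : Type`), a (spacelike, i.e. Riemannian) immersion `f : S₀ → X` with
`range f = N`, and a unit normal field `ν` along `f`, smooth as a map into `TX` (so that the mean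
curvature of `Hypersurface.lean` is the honest one), with vanishing mean curvature `H = 0`
(`IsMaximalSlice`); `hpb` is the pullback-smoothness fact of `Isometry.lean` needed to state it.
Immersions with non-trivial normal bundle are covered through their two-sided double covers,
which have the same image. [cite: HuiskenIlmanenIMCF2001, §4 (Exterior and Trapped Regions)] -/
def IsMinimalSurfaceImage (N : Set X) : Prop :=
  ∃ (S₀ : Type) (_ : TopologicalSpace S₀) (_ : ChartedSpace (EuclideanSpace ℝ (Fin 2)) S₀)
    (_ : IsManifold (𝓡 2) ∞ S₀) (_ : CompactSpace S₀) (_ : T2Space S₀) (_ : Nonempty S₀)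
    (f : S₀ → X) (ν : NormalField (𝓡 3) f)
    (hpb : contMDiff_pullbackBilin (𝓡 3) X (𝓡 2) S₀ ∞)
    (hf : (ofRiemannian h).IsSpacelikeImmersion (𝓡 2) f),
    (ofRiemannian h).IsUnitNormal (𝓡 2) f ν 1 ∧
    ContMDiff (𝓡 2) (𝓡 3).tangent ∞
      (fun y ↦ (TotalSpace.mk' E3 (f y) (ν y) : TangentBundle (𝓡 3) X)) ∧
    (ofRiemannian h).IsMaximalSlice f hpb hf ν ∧ range f = N

/-- The set `K₁(V)` of the region `V ⊆ X`: *the closure of the union of the images of all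
compact immersed minimal surfaces in `closure V`* (Huisken–Ilmanen, J. Differential Geom. 59
(2001), §4, the set `K₁` of the manifold `M = closure V`).
[cite: HuiskenIlmanenIMCF2001, §4 (Exterior and Trapped Regions)] -/
def trappedCore (V : Set X) : Set X :=
  closure (⋃₀ {N | IsMinimalSurfaceImage h N ∧ N ⊆ closure V})

/-- The **trapped set** `K(V)` of the region `V ⊆ X`: *the union of `K₁(V)` with the bounded
(i.e. precompact) connected components of `V ∖ K₁(V)`* (Huisken–Ilmanen, J. Differential Geom.
59 (2001), §4, "the trapped region `K`" of `M = closure V`; the components of `M ∖ K₁` are those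
of `V ∖ K₁(V)` since `∂M ⊆ K₁`).
[cite: HuiskenIlmanenIMCF2001, §4 (Exterior and Trapped Regions)] -/
def trappedSet (V : Set X) : Set X :=
  trappedCore h V ∪
    ⋃₀ {C | (∃ x ∈ V \ trappedCore h V, C = connectedComponentIn (V \ trappedCore h V) x) ∧
      IsCompact (closure C)}

variable {h}

/-- The image of a compact minimal surface contained in `closure V` lies in `K₁(V)` (by
definition). Huisken–Ilmanen 2001, §4. [cite: HuiskenIlmanenIMCF2001, §4] -/
lemma subset_trappedCore {N V : Set X} (hN : IsMinimalSurfaceImage h N) (hNV : N ⊆ closure V) :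
    N ⊆ trappedCore h V :=
  (subset_sUnion_of_mem
    (show N ∈ {N | IsMinimalSurfaceImage h N ∧ N ⊆ closure V} from ⟨hN, hNV⟩)).trans
    subset_closure

/-- `K₁(V) ⊆ K(V)` (by definition). Huisken–Ilmanen 2001, §4. [cite: HuiskenIlmanenIMCF2001, §4] -/
lemma trappedCore_subset_trappedSet (V : Set X) : trappedCore h V ⊆ trappedSet h V :=
  subset_union_left

/-- `K₁(V)` is closed (it is a closure). Huisken–Ilmanen 2001, §4.
[cite: HuiskenIlmanenIMCF2001, §4] -/
lemma isClosed_trappedCore (V : Set X) : IsClosed (trappedCore h V) :=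
  isClosed_closure

end TrappedSet

/-! ### Open regions with compact minimal boundary -/

/-- Hypothesis structure: *the topological boundary of the region `U ⊆ X` is a compact minimal
surface*, the first clause of hypothesis (iii) of Huisken–Ilmanen's Main Theorem ("the boundary
of `M` is compact and consists of minimal surfaces", J. Differential Geom. 59 (2001), §0) and the
standing assumption of their §4 ("we allow `M` to have a smooth, compact boundary consisting of
minimal surfaces"), for `M = closure U` (resp. the metric completion of `U`) presented inside the
boundaryless `3`-manifold `X`. It bundles a compact Hausdorff surface type `surf` (possibly
disconnected, possibly empty; with a Borel structure for areas), a smooth embedding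
`f : surf → X` with `range f = frontier U`, which is a (spacelike) immersion for `h`, and a unit
normal field `ν` along `f` which is **smooth** as a map into `TX` (so that `IsMaximalSlice`,
`H = 0`, is the honest minimal surface equation — cf. the section "corrected statement" of
`MassInequalities.lean`), has vanishing mean curvature, and points into `U` in the sense of
`OutermostMOTS.pointsInto` (the chart-straight curve with velocity `ν y` lies in `U` for small
`t > 0`; along a component on both of whose sides `U` lies this holds for either sign). The
fields `hpb` and the ambient `[(ofRiemannian h).HasLeviCivita]` are the standing smoothness and
Levi-Civita hypotheses of `Hypersurface.lean`. Bracketed fields are instances.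
[cite: HuiskenIlmanenIMCF2001, Main Theorem (iii) and §4] -/
structure MinimalBoundary
    (h : ContMDiffRiemannianMetric (𝓡 3) ∞ E3 (TangentSpace (𝓡 3) : X → Type _))
    [(ofRiemannian h).HasLeviCivita] (U : Set X) where
  /-- The surface type of the boundary (possibly disconnected or empty). -/
  surf : Type
  /-- Topology of the boundary surface. -/
  [top : TopologicalSpace surf]
  /-- The boundary surface is a `2`-manifold without boundary. -/
  [charted : ChartedSpace (EuclideanSpace ℝ (Fin 2)) surf]
  /-- The boundary surface is a smooth manifold. -/
  [mfd : IsManifold (𝓡 2) ∞ surf]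
  /-- The boundary surface is compact. -/
  [compact : CompactSpace surf]
  /-- The boundary surface is Hausdorff. -/
  [t2 : T2Space surf]
  /-- Measurable structure of the boundary surface (for areas). -/
  [meas : MeasurableSpace surf]
  /-- The measurable structure is the Borel one. -/
  [borel : BorelSpace surf]
  /-- Smoothness of pullbacks of bilinear forms to `surf` (named fact of `Isometry.lean`). -/
  hpb : contMDiff_pullbackBilin (𝓡 3) X (𝓡 2) surf ∞
  /-- The embedding of the boundary surface. -/
  f : surf → X
  /-- The unit normal along `f` pointing into `U`. -/
  ν : NormalField (𝓡 3) f
  /-- `f` is a (spacelike) immersion into `(X, h)`. -/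
  isSpacelikeImmersion : (ofRiemannian h).IsSpacelikeImmersion (𝓡 2) f
  /-- `f` is a smooth embedding. -/
  isEmbedding : Manifold.IsSmoothEmbedding (𝓡 2) (𝓡 3) ∞ f
  /-- `ν` is a unit normal (`h(ν, ν) = 1`, `ν ⊥ df`). -/
  isUnitNormal : (ofRiemannian h).IsUnitNormal (𝓡 2) f ν 1
  /-- `ν` is smooth as a map `surf → TX`. -/
  contMDiff_normal : ContMDiff (𝓡 2) (𝓡 3).tangent ∞
    fun y ↦ (TotalSpace.mk' E3 (f y) (ν y) : TangentBundle (𝓡 3) X)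
  /-- The boundary is a minimal surface: `H = 0`. -/
  isMinimal : (ofRiemannian h).IsMaximalSlice f hpb isSpacelikeImmersion ν
  /-- The image of `f` is the topological boundary of `U`. -/
  frontier_eq : frontier U = range f
  /-- `ν` points into `U`: the chart-straight curve through `f y` with velocity `ν y` lies in `U`
  for small `t > 0`. -/
  pointsInto (y : surf) : ∀ᶠ t in 𝓝[>] (0 : ℝ), curveThrough (𝓡 3) (f y) (ν y) t ∈ U

namespace MinimalBoundary

attribute [instance] top charted mfd compact t2 meas borel

variable {h : ContMDiffRiemannianMetric (𝓡 3) ∞ E3 (TangentSpace (𝓡 3) : X → Type _)}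
  [(ofRiemannian h).HasLeviCivita] {U : Set X}

/-- The boundary surface has compact image. [folklore] -/
lemma isCompact_range (B : MinimalBoundary h U) : IsCompact (range B.f) :=
  _root_.isCompact_range B.isEmbedding.isEmbedding.continuous

/-- The boundary of an *open* region does not meet the region. [folklore] -/
lemma range_inter_eq_empty (B : MinimalBoundary h U) (hU : IsOpen U) : range B.f ∩ U = ∅ := by
  rw [← B.frontier_eq, ← disjoint_iff_inter_eq_empty]
  exact disjoint_frontier_iff_isOpen.mpr hU

/-- The boundary lies in the closure of the region. [folklore] -/
lemma range_subset_closure (B : MinimalBoundary h U) : range B.f ⊆ closure U := by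
  rw [← B.frontier_eq]
  exact frontier_subset_closure

/-- A nonempty minimal boundary is the image of a compact minimal surface (non-vacuity of
`IsMinimalSurfaceImage`). Huisken–Ilmanen 2001, §4 (`∂M ⊆ K₁`).
[cite: HuiskenIlmanenIMCF2001, §4] -/
lemma isMinimalSurfaceImage_range (B : MinimalBoundary h U) [Nonempty B.surf] :
    IsMinimalSurfaceImage h (range B.f) :=
  ⟨B.surf, B.top, B.charted, B.mfd, B.compact, B.t2, ‹_›, B.f, B.ν, B.hpb, B.isSpacelikeImmersion,
    B.isUnitNormal, B.contMDiff_normal, B.isMinimal, rfl⟩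

/-- A nonempty minimal boundary of `V` lies in `K₁(V)`. Huisken–Ilmanen 2001, §4 (`∂M ⊆ K₁`).
[cite: HuiskenIlmanenIMCF2001, §4] -/
lemma range_subset_trappedCore (B : MinimalBoundary h U) [Nonempty B.surf] :
    range B.f ⊆ trappedCore h U :=
  subset_trappedCore B.isMinimalSurfaceImage_range B.range_subset_closure

end MinimalBoundary

/-! #### The empty boundary -/

/-- The *empty surface*: the empty open subset of the model plane `ℝ²`, a compact smooth
`2`-manifold with no points (used as the boundary surface type of a region with empty
topological boundary). [folklore] -/
abbrev EmptySurface : Type :=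
  (⊥ : Opens (EuclideanSpace ℝ (Fin 2)))

/-- The empty surface has no points. [folklore] -/
instance : IsEmpty EmptySurface :=
  ⟨fun y ↦ (y.2 : y.1 ∈ ((⊥ : Opens (EuclideanSpace ℝ (Fin 2))) : Set _))⟩

omit [IsManifold (𝓡 3) ∞ X] in
/-- Pullbacks of bilinear forms to the empty surface are (vacuously) smooth: the named fact
`contMDiff_pullbackBilin` holds for the empty source. [folklore] -/
lemma contMDiff_pullbackBilin_emptySurface :
    contMDiff_pullbackBilin (𝓡 3) X (𝓡 2) EmptySurface ∞ := by
  intro _ _ _ _ _ y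
  exact isEmptyElim y

namespace MinimalBoundary

variable {h : ContMDiffRiemannianMetric (𝓡 3) ∞ E3 (TangentSpace (𝓡 3) : X → Type _)}
  [(ofRiemannian h).HasLeviCivita] {U : Set X}

variable (h) in
/-- A region with empty topological boundary (e.g. `U = univ`, the case `∂M = ∅` of
Huisken–Ilmanen's Main Theorem and §4) has the empty minimal boundary. Non-vacuity of the
hypothesis structure `MinimalBoundary`. Huisken–Ilmanen 2001, §8, step 1 ("if `M` has no
boundary"). [cite: HuiskenIlmanenIMCF2001, §8 step 1] -/
def ofFrontierEqEmpty (hU : frontier U = ∅) : MinimalBoundary h U where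
  surf := EmptySurface
  hpb := contMDiff_pullbackBilin_emptySurface
  f := isEmptyElim
  ν := isEmptyElim
  isSpacelikeImmersion := ⟨fun y ↦ isEmptyElim y, fun y ↦ isEmptyElim y⟩
  isEmbedding :=
    ⟨⟨EuclideanSpace ℝ (Fin 1), inferInstance, inferInstance, fun y ↦ isEmptyElim y⟩,
      .of_subsingleton _⟩
  isUnitNormal := ⟨fun y ↦ isEmptyElim y, fun y ↦ isEmptyElim y⟩
  contMDiff_normal := fun y ↦ isEmptyElim y
  isMinimal := fun y ↦ isEmptyElim y
  frontier_eq := by rw [hU, Set.range_eq_empty]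
  pointsInto := fun y ↦ isEmptyElim y

variable (h) in
/-- The whole (connected, boundaryless) manifold has the empty minimal boundary.
Huisken–Ilmanen 2001, §8, step 1. [cite: HuiskenIlmanenIMCF2001, §8 step 1] -/
def univ : MinimalBoundary h (Set.univ : Set X) :=
  ofFrontierEqEmpty h frontier_univ

end MinimalBoundary

/-- The exterior region of an outermost minimal surface `S` of time-symmetric data (`k = 0`)
whose unit normal is smooth has `S` as its minimal boundary: `frontier S.exterior = range S.f`,
`H = 0` by `isMOTSInData_zero_iff`, and `S.ν` points into `S.exterior`.
Huisken–Ilmanen 2001, §0, "Physical Interpretation" with footnote 3 (if the extrinsic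
curvature vanishes along `N`, the minimal boundary represents a marginally trapped surface); the
mathematics is the prelude lemma `isMOTSInData_zero_iff`.
[cite: HuiskenIlmanenIMCF2001, §0, Physical Interpretation and footnote 3] -/
def OutermostMOTS.toMinimalBoundary {X : Type} [TopologicalSpace X]
    [ChartedSpace E3 X] [IsManifold (𝓡 3) ∞ X]
    {h : ContMDiffRiemannianMetric (𝓡 3) ∞ E3 (TangentSpace (𝓡 3) : X → Type _)}
    [(ofRiemannian h).HasLeviCivita] (S : OutermostMOTS (𝓡 3) h 0)
    (hν : ContMDiff (𝓡 2) (𝓡 3).tangent ∞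
      (fun y ↦ (TotalSpace.mk' E3 (S.f y) (S.ν y) : TangentBundle (𝓡 3) X))) :
    MinimalBoundary h (S.exterior : Set X) where
  surf := S.surf
  hpb := S.hpb
  f := S.f
  ν := S.ν
  isSpacelikeImmersion := S.isSpacelikeImmersion
  isEmbedding := S.isEmbedding
  isUnitNormal := S.isUnitNormal
  contMDiff_normal := hν
  isMinimal := (isMOTSInData_zero_iff h S.f S.hpb S.isSpacelikeImmersion S.ν).1 S.isMOTS
  frontier_eq := S.frontier_exterior
  pointsInto := S.pointsInto

/-- Unfolding lemma: the boundary map of `S.toMinimalBoundary hν` is `S.f`. [folklore] -/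
@[simp]
lemma OutermostMOTS.toMinimalBoundary_f {X : Type} [TopologicalSpace X]
    [ChartedSpace E3 X] [IsManifold (𝓡 3) ∞ X]
    {h : ContMDiffRiemannianMetric (𝓡 3) ∞ E3 (TangentSpace (𝓡 3) : X → Type _)}
    [(ofRiemannian h).HasLeviCivita] (S : OutermostMOTS (𝓡 3) h 0)
    (hν : ContMDiff (𝓡 2) (𝓡 3).tangent ∞
      (fun y ↦ (TotalSpace.mk' E3 (S.f y) (S.ν y) : TangentBundle (𝓡 3) X))) :
    (S.toMinimalBoundary hν).f = S.f :=
  rfl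

/-! ### Huisken–Ilmanen, Lemma 4.1: the exterior region of an end -/

/-- **Structure of exterior regions** (named fact; **refuted as stated, 2026-08-15**: the
conclusion asks for an *embedded* boundary of `U = V ∖ K(V)` with a *smooth* unit normal and
`2`-sphere components, which fails when a component of `K(V)` is a one-sided minimal surface —
the case for which Huisken–Ilmanen take the metric completion; counterexample: the
time-symmetric slice of the `ℝP³` geon with `V = univ`, see the module docstring, section "Known
exception". Kept verbatim for its users; every implication from it is vacuous).
Huisken–Ilmanen, J. Differential Geom. 59
(2001), §4, the paragraph "Exterior and Trapped Regions" and Lemma 4.1 (i): *let `M` be a complete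
`3`-manifold with asymptotically flat ends, allowed to have a smooth compact boundary consisting
of minimal surfaces; let `K₁` be the closure of the union of the images of all smooth compact
immersed minimal surfaces in `M` — since the region near infinity is foliated by spheres of
positive mean curvature, `K₁` is compact — and let the trapped region `K` be the union of `K₁`
with the bounded components of `M ∖ K₁`; `K` is compact as well, and `M ∖ K` contains exactly one
connected component corresponding to each end of `M`. (i) The topological boundary of `K`
consists of smooth embedded minimal `2`-spheres, and the metric completion `M'` of any component
of `M ∖ K` is an exterior region, i.e. connected, asymptotically flat, with compact minimal
boundary and no other compact minimal surfaces (even immersed).* Vendored for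
`M = closure V`, where `V ⊆ X` is an open connected region of the complete boundaryless data
manifold `(X, h)` whose topological boundary is a compact minimal surface (`MinimalBoundary`,
possibly empty; `M` is a manifold with boundary the components of `frontier V` on one side of
which `V` lies, the other components being interior minimal surfaces of `M`, contained in `K₁`)
and which has exactly one end, the asymptotically flat end `e` (`IsExteriorRegion e V` of
`MassInequalities.lean`: `V` connected, `e.far R' ⊆ V` and `closure V ∖ e.far R'` compact for
some `R' > e.R`; metric decay `h - δ = O₂(r⁻¹)`, `IsMetricAsymptoticallyFlat e D 1`, which gives
(0.1)). Conclusions vendored: `K(V)` (`trappedSet`) is compact; the complement `U = V ∖ K(V)` is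
open and again `IsExteriorRegion e U` — connected (the one component of `M ∖ K`, that of the end
`e`), containing a far region `e.far R''` with `closure U ∖ e.far R''` compact (so `M'` has the
one asymptotically flat end) — and its topological boundary
`frontier U = ∂K` is a compact embedded minimal surface with smooth unit normal pointing into
`U` (`MinimalBoundary D.h U`; embedded `2`-spheres are two-sided, so such a normal exists) all of
whose components are `2`-spheres. Not vendored: Lemma 4.1 (ii) (`M' ≅ ℝ³` minus finitely many
balls; `∂M'` minimises area in its homology class). That `M'` contains no other compact minimal
surface is, in this encoding, the definitional consequence
`subset_frontier_of_isMinimalSurfaceImage` of `U = V ∖ K(V)`. The tensor `k` of `D` plays no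
role (the statement concerns `(X, h)` only).
[cite: HuiskenIlmanenIMCF2001, §4, Lemma 4.1 (i) and the preceding paragraph] -/
def exteriorRegion_structure : Prop :=
  ∀ (X : Type) [TopologicalSpace X] [ChartedSpace E3 X] [IsManifold (𝓡 3) ∞ X] [T2Space X]
    [SecondCountableTopology X] [ConnectedSpace X]
    (D : InitialDataSet (𝓡 3) X) [D.metric.HasLeviCivita] (e : AFEnd X) (V : Opens X)
    (_ : MinimalBoundary D.h (V : Set X)),
    D.IsComplete → IsExteriorRegion e V → e.IsMetricAsymptoticallyFlat D 1 →
    IsCompact (trappedSet D.h (V : Set X)) ∧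
    ∃ (U : Opens X) (B : MinimalBoundary D.h (U : Set X)),
      (U : Set X) = (V : Set X) \ trappedSet D.h (V : Set X) ∧ IsExteriorRegion e U ∧
      ∀ y : B.surf, Nonempty (connectedComponent y ≃ₜ Metric.sphere (0 : E3) 1)

/-! ### Huisken–Ilmanen, Main Theorem, for exterior regions -/

/-- **Riemannian Penrose inequality for exterior regions** (named fact). Huisken–Ilmanen,
J. Differential Geom. 59 (2001), Main Theorem (§0): *let `M` be a complete, connected
`3`-manifold such that (i) `M` has nonnegative scalar curvature, (ii) `M` is asymptotically flat
satisfying (0.1) (`|g_ij - δ_ij| ≤ C/|x|`, `|g_ij,k| ≤ C/|x|²`, `Rc ≥ -Cg/|x|²` on an end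
`≅ ℝ³ ∖ K`) with ADM mass `m` (the flux limit (0.2)), (iii) the boundary of `M` is compact and
consists of minimal surfaces, and `M` contains no other compact minimal surfaces (even immersed,
§4); then `m ≥ 0` and `16π m² ≥ |N|`, where `|N|` is the area of any connected component `N` of
`∂M`* (proof: §8, step 1). Vendored for `M` the metric completion of an open connected region
`U` of the complete boundaryless data manifold `(X, h)` (`D.IsComplete`) with compact minimal
topological boundary `∂U = range B.f` (`B : MinimalBoundary D.h U`: a compact embedded surface
with smooth unit normal pointing into `U` and `H = 0`; a component of `∂U` on both of whose sides
`U` lies gives two components of `∂M`) and exactly one end, the asymptotically flat end `e`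
(`IsExteriorRegion e U`: `U` connected, `e.far R' ⊆ U`, `closure U ∖ e.far R'` compact;
`h - δ = O₂(r⁻¹)` in the chart of `e`, which implies (0.1); and existence of the ADM energy flux
limit, which is then `m = e.admEnergy D`, (0.2) and Lemma 7.3); hypothesis (i) as `R(h) ≥ 0`
on `closure U`; the second clause of (iii) as: every image of a compact immersed minimal surface
of `X` contained in `closure U` is contained in `∂U` (this also excludes surfaces crossing a
two-sided component of `∂U`, so it is at least as strong as the printed clause). Conclusions:
`0 ≤ m`, and `√(|N|/16π) ≤ m` for every compact connected surface `S₀` smoothly embedded into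
`X` by `f₀` with `range f₀ ⊆ ∂U` — such an image is a whole component `N` of `∂U` (invariance
of domain), and `|N|` is the total area of the induced
metric `f₀^* h` (`totalArea`, Federer 1969, §3.2.46), the form in which
`OutermostMOTS.surfaceArea` is defined. The rigidity clause (equality iff half Schwarzschild) is
not vendored. The tensor `k` of `D` plays no role.
[cite: HuiskenIlmanenIMCF2001, Main Theorem (§0, (0.1)–(0.3)) and §8 step 1] -/
def riemannian_penrose_inequality_exteriorRegion : Prop :=
  ∀ (X : Type) [TopologicalSpace X] [ChartedSpace E3 X] [IsManifold (𝓡 3) ∞ X] [T2Space X]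
    [SecondCountableTopology X] [ConnectedSpace X]
    (D : InitialDataSet (𝓡 3) X) [D.metric.HasLeviCivita] (e : AFEnd X) (U : Opens X)
    (B : MinimalBoundary D.h (U : Set X)),
    D.IsComplete → IsExteriorRegion e U → e.IsMetricAsymptoticallyFlat D 1 →
    (∃ m, e.HasADMEnergy D m) →
    (∀ x ∈ closure (U : Set X), 0 ≤ D.metric.scalarCurvature x) →
    (∀ N, IsMinimalSurfaceImage D.h N → N ⊆ closure (U : Set X) → N ⊆ range B.f) →
    0 ≤ e.admEnergy D ∧
    ∀ (S₀ : Type) [TopologicalSpace S₀] [ChartedSpace (EuclideanSpace ℝ (Fin 2)) S₀]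
      [IsManifold (𝓡 2) ∞ S₀] [CompactSpace S₀] [T2Space S₀] [ConnectedSpace S₀]
      [MeasurableSpace S₀] [BorelSpace S₀]
      (f₀ : S₀ → X) (hpb₀ : contMDiff_pullbackBilin (𝓡 3) X (𝓡 2) S₀ ∞)
      (hf₀ : (ofRiemannian D.h).IsSpacelikeImmersion (𝓡 2) f₀),
      Manifold.IsSmoothEmbedding (𝓡 2) (𝓡 3) ∞ f₀ → range f₀ ⊆ range B.f →
      Real.sqrt ((totalArea ((ofRiemannian D.h).inducedRiemannianMetric f₀ hpb₀ hf₀)).toReal /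
        (16 * π)) ≤ e.admEnergy D

/-! ### The boundary maximum principle for minimal surfaces -/

/-- **Strong maximum principle for minimal surfaces, boundary form** (named fact). The
geometric maximum principle — Andersson–Galloway–Howard, Comm. Pure Appl. Math. 51 (1998),
Thm. 3.10: *in a Riemannian manifold let `U₀`, `U₁` be disjoint open sets whose boundaries have
mean curvature `≥ -H₀` in the sense of contact hypersurfaces, resp. `≥ H₀` in the sense of
contact hypersurfaces with a one-sided Hessian bound (Def. 3.9; both implied by the classical
sense for `C²` boundaries, the Hessian bound being automatic here for the smooth compact surface
`range f` used as `∂U₁`), and let `p ∈ Ū₀ ∩ Ū₁` have a coordinate box in which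
`U₀ = {xⁿ > u₀}`, `U₁ = {xⁿ < u₁}` with `u₀, u₁` Lipschitz; then `u₀ ≡ u₁`, so `∂U₀ = ∂U₁` near
`p`*; the classical `C²` version is Eschenburg, Manuscripta Math. 64 (1989), Thm. 1 (disjoint
open domains whose `C²` boundaries have a common point and oppositely bounded mean curvatures
have equal boundaries) — here in the form in which Huisken–Ilmanen use it in §4 (proof of
Lemma 4.1: minimal surfaces touching `∂K` one-sidedly lie in it). Statement: let `U ⊆ X` be
open with compact minimal boundary `∂U = range B.f` (`MinimalBoundary`), and let `f : S₀ → X`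
be a smooth embedding of a compact *connected* surface, minimal (`H = 0` for a smooth unit
normal `ν`), whose image does not meet `U` but meets `∂U`; then `range f ⊆ ∂U`. Derivation from
the cited theorem (`H₀ = 0`): at a common point `p`, in a slice-chart box of the embedded
surface `∂U` centred at `p` (Lee 2013, Prop. 5.2 and Thm. 5.8), `U` is a nonempty union of the
two open half-boxes (it is open, misses `∂U`, is relatively closed off `∂U`, and accumulates at
`p`). If it is both, `range f`, which misses `U`, lies in `∂U` near `p`. Otherwise `U` is one
half-box `U₀ = {x³ > 0}` there and `range f` lies in `{x³ ≤ 0}`, touches `∂U₀` at `p`, is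
tangent to it there, hence is near `p` a graph `{x³ = u₁}` with `u₁ ≤ 0 = u₀` smooth, bounding
`U₁ = {x³ < u₁}` disjoint from `U₀`; both boundaries are minimal, so `u₁ ≡ 0`, i.e. `range f`
agrees with `∂U` near `p`. Thus `f ⁻¹' (∂U)` is open, closed and nonempty in the connected
`S₀`. This derivation is machine-checked downstream: `MinimalSurfaceBarrier.lean` proves the slice
box (`exists_sliceBox`, from Mathlib's slice-chart immersions) and
`minimalSurface_boundary_maximumPrinciple_of_barrierPrinciple :
minimalSurface_barrierPrinciple → minimalSurface_boundary_maximumPrinciple`, leaving only the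
local barrier (tangency) principle for two minimal surfaces as the named fact.
[cite: AnderssonGallowayHoward1998, Thm. 3.10 and Def. 3.9]
[cite: Eschenburg1989, Thm. 1]
[cite: LeeSmoothManifolds2013, Prop. 5.2 and Thm. 5.8] -/
def minimalSurface_boundary_maximumPrinciple : Prop :=
  ∀ (X : Type) [TopologicalSpace X] [ChartedSpace E3 X] [IsManifold (𝓡 3) ∞ X] [T2Space X]
    [SecondCountableTopology X]
    (h : ContMDiffRiemannianMetric (𝓡 3) ∞ E3 (TangentSpace (𝓡 3) : X → Type _))
    [(ofRiemannian h).HasLeviCivita] (U : Opens X) (B : MinimalBoundary h (U : Set X))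
    (S₀ : Type) [TopologicalSpace S₀] [ChartedSpace (EuclideanSpace ℝ (Fin 2)) S₀]
    [IsManifold (𝓡 2) ∞ S₀] [CompactSpace S₀] [T2Space S₀] [ConnectedSpace S₀]
    (f : S₀ → X) (ν : NormalField (𝓡 3) f) (hpb : contMDiff_pullbackBilin (𝓡 3) X (𝓡 2) S₀ ∞)
    (hf : (ofRiemannian h).IsSpacelikeImmersion (𝓡 2) f),
    Manifold.IsSmoothEmbedding (𝓡 2) (𝓡 3) ∞ f → (ofRiemannian h).IsUnitNormal (𝓡 2) f ν 1 →
    ContMDiff (𝓡 2) (𝓡 3).tangent ∞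
      (fun y ↦ (TotalSpace.mk' E3 (f y) (ν y) : TangentBundle (𝓡 3) X)) →
    (ofRiemannian h).IsMaximalSlice f hpb hf ν →
    Disjoint (range f) (U : Set X) → (range f ∩ range B.f).Nonempty → range f ⊆ range B.f

/-! ### Reduction of the connected-horizon Penrose inequality to the exterior-region form -/

section Reduction

variable {X : Type} [TopologicalSpace X] [ChartedSpace E3 X] [IsManifold (𝓡 3) ∞ X]

/-- *The exterior region contains no other compact minimal surface* (Huisken–Ilmanen 2001,
Lemma 4.1 (i), last clause, in the open-set encoding): if `U = V ∖ K(V)` is open, every image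
of a compact immersed minimal surface contained in `closure U` lies in `frontier U` — it lies in
`closure V`, hence in `K₁(V) ⊆ K(V)`, hence misses `U`.
[cite: HuiskenIlmanenIMCF2001, §4, Lemma 4.1 (i)] -/
lemma subset_frontier_of_isMinimalSurfaceImage
    {h : ContMDiffRiemannianMetric (𝓡 3) ∞ E3 (TangentSpace (𝓡 3) : X → Type _)}
    [(ofRiemannian h).HasLeviCivita] {V U : Set X} (hU : IsOpen U)
    (hUV : U = V \ trappedSet h V) {N : Set X} (hN : IsMinimalSurfaceImage h N)
    (hNU : N ⊆ closure U) : N ⊆ frontier U := by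
  have hUV' : U ⊆ V := hUV ▸ sdiff_subset
  have hNK : N ⊆ trappedSet h V :=
    (subset_trappedCore hN (hNU.trans (closure_mono hUV'))).trans (trappedCore_subset_trappedSet V)
  intro x hx
  refine ⟨hNU hx, ?_⟩
  rw [hU.interior_eq]
  intro hxU
  rw [hUV] at hxU
  exact hxU.2 (hNK hx)

/-- **The trichotomy behind reduction (a)** (Huisken–Ilmanen 2001, §4 with the outermost
condition of `OutermostMOTS`). Let `S` be an outermost minimal surface of the time-symmetric data
`(X, h, 0)` with smooth unit normal, `V = S.exterior`, and let `U ⊆ V` be open with compact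
minimal boundary `∂U = range B.f` such that `closure (V ∖ U)` is compact. Then either
`range S.f ⊆ ∂U`, or `S` touches `∂U` without lying in it (`range S.f ∩ ∂U ≠ ∅`,
`range S.f ⊄ ∂U`; excluded by the maximum principle when `S` is connected), — the third
possibility, `∂U ⊆ S.exterior` disjoint from `S`, being excluded: `∂U` would be a compact minimal,
hence weakly outer trapped (`isMOTSInData_zero_iff`), surface inside `S.exterior` enclosing `S`
with compact region `closure (S.exterior ∖ U)` in between, contradicting
`OutermostMOTS.no_weaklyOuterTrapped_in_exterior`.
[cite: HuiskenIlmanenIMCF2001, §4, Lemma 4.1 and §8 step 1] -/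
theorem OutermostMOTS.range_inter_minimalBoundary_nonempty
    {h : ContMDiffRiemannianMetric (𝓡 3) ∞ E3 (TangentSpace (𝓡 3) : X → Type _)}
    [(ofRiemannian h).HasLeviCivita] (S : OutermostMOTS (𝓡 3) h 0) {U : Opens X}
    (B : MinimalBoundary h (U : Set X)) (hUV : (U : Set X) ⊆ (S.exterior : Set X))
    (hcpt : IsCompact (closure ((S.exterior : Set X) \ (U : Set X)))) :
    (range S.f ∩ range B.f).Nonempty := by
  by_contra hmeet
  rw [not_nonempty_iff_eq_empty] at hmeet
  have hBV : range B.f ⊆ (S.exterior : Set X) := by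
    intro x hx
    have hx' : x ∈ closure (S.exterior : Set X) := closure_mono hUV (B.range_subset_closure hx)
    rw [closure_eq_self_union_frontier, S.frontier_exterior] at hx'
    rcases hx' with hxV | hxS
    · exact hxV
    · exact (Set.eq_empty_iff_forall_notMem.1 hmeet x ⟨hxS, hx⟩).elim
  exact S.no_weaklyOuterTrapped_in_exterior B.surf B.f B.ν B.hpb B.isSpacelikeImmersion U
    B.isEmbedding hBV hUV B.frontier_eq hcpt B.pointsInto B.isUnitNormal
    ((isMOTSInData_zero_iff h B.f B.hpb B.isSpacelikeImmersion B.ν).2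
      B.isMinimal).isWeaklyOuterTrapped

/-- **gr.S09, connected horizon: the reduction to the exterior-region form, proved.** The named
facts `exteriorRegion_structure` (Huisken–Ilmanen 2001, Lemma 4.1),
`riemannian_penrose_inequality_exteriorRegion` (their Main Theorem for exterior regions) and
`minimalSurface_boundary_maximumPrinciple` (the strong maximum principle for minimal surfaces,
boundary form) imply `riemannian_penrose_inequality_connected_smooth`. Proof (reduction (a) of
the module docstring of `MassInequalities.lean`; Huisken–Ilmanen 2001, §4 and §8, step 1): let
`V = S.exterior` with minimal boundary `S` (`OutermostMOTS.toMinimalBoundary`); Lemma 4.1 gives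
the compact trapped set `K(V)` and the exterior component `U = V ∖ K(V)` with minimal boundary
`B`, containing the end and with `closure U ∖ e.far R''` compact; no compact minimal surface in
`closure U` survives outside `∂U` (`subset_frontier_of_isMinimalSurfaceImage`). If
`range S.f ⊆ ∂U`, the Main Theorem applied to `U` and the boundary component parametrised by
`S.f` is the claim (`S.surfaceArea = totalArea (S.f^* h)` by definition). Otherwise `S` meets `∂U`
(`OutermostMOTS.range_inter_minimalBoundary_nonempty`, using `closure (V ∖ U) ⊆ K(V)` compact)
without lying in it, while `range S.f ∩ U = ∅` (`U ⊆ S.exterior`): impossible by the maximum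
principle, `S` being connected. The same reduction with `h5` discharged from the barrier
principle `minimalSurface_barrierPrinciple` is
`riemannian_penrose_inequality_connected_smooth_of_barrierPrinciple` (`MinimalSurfaceBarrier.lean`).
[cite: HuiskenIlmanenIMCF2001, Main Theorem, Lemma 4.1 and §8 step 1] -/
theorem riemannian_penrose_inequality_connected_smooth_of_exteriorRegion
    (h1 : exteriorRegion_structure) (h2 : riemannian_penrose_inequality_exteriorRegion)
    (h5 : minimalSurface_boundary_maximumPrinciple) :
    riemannian_penrose_inequality_connected_smooth := by
  intro X _ _ _ _ _ _ D _ e S hν _hts hR hAF hcomp hADM hconn hext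
  -- the exterior `V = S.exterior` with its minimal boundary `S`, and its exterior component `U`
  obtain ⟨hK, U, B, hUV, hUext, -⟩ := h1 X D e S.exterior (S.toMinimalBoundary hν)
    hcomp hext hAF.isMetricAsymptoticallyFlat
  have hUV' : (U : Set X) ⊆ (S.exterior : Set X) := hUV ▸ sdiff_subset
  -- no other compact minimal surfaces in `closure U`
  have hiii : ∀ N, IsMinimalSurfaceImage D.h N → N ⊆ closure (U : Set X) → N ⊆ range B.f := by
    intro N hN hNU
    rw [← B.frontier_eq]
    exact subset_frontier_of_isMinimalSurfaceImage U.isOpen hUV hN hNU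
  by_cases hS : range S.f ⊆ range B.f
  · -- `S` is a boundary component of the exterior region `U`: the Main Theorem applies
    exact (h2 X D e U B hcomp hUext hAF.isMetricAsymptoticallyFlat hADM
      (fun x _ ↦ hR x) hiii).2 S.surf S.f S.hpb S.isSpacelikeImmersion S.isEmbedding hS
  -- otherwise `S` touches `∂U` from outside `U` without lying in it: impossible
  have hSU : Disjoint (range S.f) (U : Set X) := by
    rw [Set.disjoint_iff_inter_eq_empty, ← Set.subset_empty_iff, ← S.range_inter_exterior]
    exact inter_subset_inter_right _ hUV'
  have hcpt : IsCompact (closure ((S.exterior : Set X) \ (U : Set X))) := by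
    refine hK.of_isClosed_subset isClosed_closure (closure_minimal ?_ hK.isClosed)
    rintro x ⟨hxV, hxU⟩
    by_contra hxK
    exact hxU (hUV ▸ ⟨hxV, hxK⟩)
  exact absurd (h5 X D.h U B S.surf S.f S.ν S.hpb S.isSpacelikeImmersion S.isEmbedding
    S.isUnitNormal hν (S.toMinimalBoundary hν).isMinimal hSU
    (S.range_inter_minimalBoundary_nonempty B hUV' hcpt)) hS

end Reduction

end Literature.Geometry.Lorentzian
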